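import Literature.NumberTheory.EllipticCurves.ZpExtensionEisensteinTwistFilIsotropyProofs
import Literature.NumberTheory.EllipticCurves.TorsionFilAtCyclicOfFrobeniusTraceProofs
import HarnessLib

/-!
# H.4 at `v ∣ p` for the curve: the strict ordinary cores of `F_𝔮` at `v` and `v̄` are orthogonal under the local pairing of
# the Eisenstein duality datum built from `(s, t) ↦ e(s, t^τ)` (assembly; theorems only, no definition, no named fact)

Topic `NumberTheory/EllipticCurves` (cell `pub/bsd-print-x9`, D1 road, memo `HOME/p1/H4-AT-P-PLAN` (E1)+(E2)+(A1); assembles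
`TorsionFilAtCyclicOfFrobeniusTraceProofs` ((E1): `Fil_v E[p^k]` is cyclic at a good ORDINARY `v ∣ p`, so any `e` with
`e(a, a) = 0` vanishes on `Fil_v × Fil_v`), `ZpExtensionEisensteinTwistFilIsotropyProofs` ((E2)+(A1): the strict ordinary cores
are `localCup`-orthogonal as soon as the `E`-level form `ẽ` kills `Fil_v × δ_v Fil_v̄`) and `ConjugatePairingDuality`
(`ẽ = conjPairing e θ log`, Howard's `(s, t) ↦ e(s, t^τ)`, Rem. 1.3.2)).

For an elliptic curve `E/K` (`W : WeierstrassCurve K`), its torsion tower `E[p^j]` with transitions `t j = (p ·)` and ordinary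
data `Fil_w E[p^j] = torsionFilAt W w (p^j)` (`ordinaryFiltrationAt`), a conjugation datum `cd`, a `ℤ_p`-twist `κ`, and at level
`k` a bi-additive `e : E[p^k] × E[p^k] → μ_{p^k}` with `e(a, a) = 0` (the Weil pairing), an additive `θ` on `E[p^k]` (the action of
`τ`) and `log : μ_{p^k} → ℤ/p^k`, such that `ẽ = conjPairing e θ log` has the four properties feeding x9-p1-w4's
`eisensteinDualityDatum`: **`WeierstrassCurve.isotropic_ordinaryCore_of_not_dvd_frobeniusTraceAt`** — at a place `v ∋ p` of good
reduction with `p ∤ a_v`, IF `θ ∘ δ_v` carries `Fil_v̄ E[p^k]` into `Fil_v E[p^k]` (PLACE COMPATIBILITY of the conjugation datum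
with the kernels of reduction — the one hypothesis left to the instantiation of `cd`/`θ`; for `ConjugationDatum.ofLifts` and
`θ` the action of `τ`, `θ ∘ δ_v = τ_v` is the lift adapted to `K̄_v̄ ≃ K̄_v`), then the strict ordinary core
`(ordinaryFiltrationAt v).ordinaryCore hm k ⊆ H¹(K_v, E[p^k] ⊗ A_{m,k}(ψ))` and the transport of the one at `v̄ = σ • v` annihilate
each other under `D.localCup (inr v)` — both «`→`» clauses of `DualityDatum.IsSelfOrthogonalAt` for the strict cores, i.e. the
(Iso) input at `v ∣ p` of the saturated-annihilator descent (`TowerSaturatedAnnihilatorProofs`, x10b-p1-w8) towards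
`SatisfiesH.h4` of D1's `eisensteinDVRSetting`. BSD is not proved by any of this.

References: [Howard2004HeegnerKolyvagin] §1.3 H.4, Rem. 1.3.2, Lemma 2.1.1, §3.1, Lemma 3.1.1, Def. 3.2.6 (arXiv:1202.6340 p. 7
L69–90, p. 15 L56–62, p. 16 L108–110); [GreenbergLNM1716] §1 p. 62, §2; [SilvermanAEC2009] III.8.1, V.3.1, VII.2.1–2.2.
-/

noncomputable section

open scoped ContRepresentation
open NumberField IsDedekindDomain Field

namespace WeierstrassCurve

open Literature.NumberTheory.EllipticCurves Literature.NumberTheory.GaloisRepresentations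
  Literature.NumberTheory.GaloisCohomology.Howard2004 Literature.NumberTheory.EllipticCurves.ZpExtension IwasawaAlgebra

variable {K : Type} [Field K] [NumberField K] (W : WeierstrassCurve K) {p : ℕ} [hp : Fact p.Prime] {m : ℕ} (hm : 1 ≤ m)
  (k : ℕ) (cd : ConjugationDatum K) (κ : ZpExtension K p)
  (t : ∀ j, (W.torsionGaloisModule ((p : ℤ) ^ (j + 1))).toContRepresentation →ⁱL
    (W.torsionGaloisModule ((p : ℤ) ^ j)).toContRepresentation)
  (ht : ∀ j (P : geomTorsion W ((p : ℤ) ^ (j + 1))), t j P = W.geomTorsionReduce p j P)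
  (e : geomTorsion W ((p : ℤ) ^ k) →+ geomTorsion W ((p : ℤ) ^ k) →+ DiscreteGaloisModule.MuCarrier K (p ^ k))
  (θ : geomTorsion W ((p : ℤ) ^ k) →+ geomTorsion W ((p : ℤ) ^ k))
  (log : DiscreteGaloisModule.MuCarrier K (p ^ k) →+ ZMod (p ^ k))
  (hsymm : ∀ a b, conjPairing e θ log a b = conjPairing e θ log b a)
  (hequiv : ∀ (g : absoluteGaloisGroup K) (a b : geomTorsion W ((p : ℤ) ^ k)),
    conjPairing e θ log (W.torsionGaloisModule _ g a) (W.torsionGaloisModule _ (cd.conj g) b) =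
      cyclotomicCharacterModPow K p k g * conjPairing e θ log a b)
  (hnd : ∀ w, (∀ b, conjPairing e θ log w b = 0) → w = 0)
  (hex : ∀ φ : geomTorsion W ((p : ℤ) ^ k) →+ ZMod (p ^ k), ∃ w, ∀ b, conjPairing e θ log w b = φ b)
  (hκ : ∀ g : absoluteGaloisGroup K,
    p ^ eisensteinLevel (p := p) hm k ∣ κ.twistExponent (eisensteinLevel (p := p) hm k) g +
      κ.twistExponent (eisensteinLevel (p := p) hm k) (cd.conj g))

/-- **The `E`-level clause of Howard's Lemma 3.1.1 at a good ordinary `v ∣ p`**: with `e(a, a) = 0` (Weil) and `θ ∘ δ_v` carrying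
`Fil_v̄ E[p^k]` into `Fil_v E[p^k]`, the form `ẽ(a, b) = log e(a, θ b)` kills `Fil_v × δ_v Fil_v̄` — because `Fil_v E[p^k]` is
cyclic (`p ∤ a_v`). [cite: Howard2004HeegnerKolyvagin, Rem. 1.3.2 and Lemma 3.1.1 (arXiv p. 7 L81–88, p. 15 L60–62)]
[cite: GreenbergLNM1716, §1 p. 62] -/
theorem conjPairing_torsionFilAt_eq_zero_of_not_dvd_frobeniusTraceAt (v : HeightOneSpectrum (𝓞 K))
    (hgood : W.HasGoodReductionAt v) (hpv : (p : 𝓞 K) ∈ v.asIdeal) (hord : ¬ ((p : ℤ) ∣ W.frobeniusTraceAt v))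
    (hself : ∀ a, e a a = 0) (g : geomTorsion W ((p : ℤ) ^ k) →+ geomTorsion W ((p : ℤ) ^ k))
    (Fil' : AddSubgroup (geomTorsion W ((p : ℤ) ^ k)))
    (hθg : ∀ a' ∈ Fil', θ (g a') ∈ W.torsionFilAt v ((p : ℤ) ^ k)) :
    ∀ a ∈ W.torsionFilAt v ((p : ℤ) ^ k), ∀ a' ∈ Fil', conjPairing e θ log a (g a') = 0 :=
  conjPairing_eq_zero_of_isotropic e θ log g (W.torsionFilAt v ((p : ℤ) ^ k)).toAddSubgroup Fil' hθg
    (W.pairing_torsionFilAt_eq_zero_of_not_dvd_frobeniusTraceAt v hgood hpv hord k e hself)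

/-- **H.4 at `v ∣ p`, isotropy half, for the curve.** At a place `v ∋ p` of good ordinary reduction (`p ∤ a_v`), for the Eisenstein
duality datum of level `k` built from `ẽ = conjPairing e θ log` (`e(a, a) = 0`) and a conjugation datum whose `θ ∘ δ_v` carries
`Fil_v̄ E[p^k]` into `Fil_v E[p^k]`: the strict ordinary core of `F_𝔮` at `v` and the transport of the one at `v̄ = σ • v` are
mutually orthogonal under the induced local pairing — the two «`→`» clauses of `DualityDatum.IsSelfOrthogonalAt` for the strict
cores `(ordinaryFiltrationAt ·).ordinaryCore hm k`. [cite: Howard2004HeegnerKolyvagin, H.4, Lemma 3.1.1 and Def. 3.2.6 (arXiv p. 7 L78–82, p. 15 L60–62, p. 16 L108–110)]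
[cite: GreenbergLNM1716, §1 p. 62] -/
theorem isotropic_ordinaryCore_of_not_dvd_frobeniusTraceAt (v : HeightOneSpectrum (𝓞 K))
    (hgood : W.HasGoodReductionAt v) (hpv : (p : 𝓞 K) ∈ v.asIdeal) (hord : ¬ ((p : ℤ) ∣ W.frobeniusTraceAt v))
    (hself : ∀ a, e a a = 0)
    (hθδ : ∀ a' ∈ W.torsionFilAt (cd.σ • v) ((p : ℤ) ^ k),
      θ (W.torsionGaloisModule ((p : ℤ) ^ k) (cd.δ v) a') ∈ W.torsionFilAt v ((p : ℤ) ^ k)) :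
    (∀ x ∈ (W.ordinaryFiltrationAt v t ht).ordinaryCore hm k,
      ∀ y ∈ ((W.ordinaryFiltrationAt (cd.σ • v) t ht).ordinaryCore hm k).map
        (cd.transportH1 (κ.eisensteinTwist (W.torsionGaloisModule ((p : ℤ) ^ k)) hm k) v),
        (eisensteinDualityDatum hm k cd κ (W.torsionGaloisModule ((p : ℤ) ^ k)) (conjPairing e θ log) hsymm hequiv hnd hex
          hκ).localCup (Sum.inr v) x y = 0) ∧
    (∀ y ∈ ((W.ordinaryFiltrationAt (cd.σ • v) t ht).ordinaryCore hm k).map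
        (cd.transportH1 (κ.eisensteinTwist (W.torsionGaloisModule ((p : ℤ) ^ k)) hm k) v),
      ∀ x ∈ (W.ordinaryFiltrationAt v t ht).ordinaryCore hm k,
        (eisensteinDualityDatum hm k cd κ (W.torsionGaloisModule ((p : ℤ) ^ k)) (conjPairing e θ log) hsymm hequiv hnd hex
          hκ).localCup (Sum.inr v) x y = 0) :=
  isotropic_ordinaryCore hm k cd κ hκ (fun j ↦ W.torsionGaloisModule ((p : ℤ) ^ j)) t (conjPairing e θ log) hsymm hequiv hnd
    hex v (W.ordinaryFiltrationAt v t ht) (W.ordinaryFiltrationAt (cd.σ • v) t ht)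
    (W.conjPairing_torsionFilAt_eq_zero_of_not_dvd_frobeniusTraceAt k e θ log v hgood hpv hord hself
      (W.torsionGaloisModule ((p : ℤ) ^ k) (cd.δ v)).toAddMonoidHom (W.torsionFilAt (cd.σ • v) ((p : ℤ) ^ k)).toAddSubgroup
      hθδ)

/-- The same, one pair at a time: `⟨x, y⟩_v = 0` for `x` in the strict ordinary core at `v` and `y` in the transport of the one at
`v̄`. [cite: Howard2004HeegnerKolyvagin, H.4 and Lemma 3.1.1] -/
theorem localCup_ordinaryCore_eq_zero_of_not_dvd_frobeniusTraceAt (v : HeightOneSpectrum (𝓞 K))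
    (hgood : W.HasGoodReductionAt v) (hpv : (p : 𝓞 K) ∈ v.asIdeal) (hord : ¬ ((p : ℤ) ∣ W.frobeniusTraceAt v))
    (hself : ∀ a, e a a = 0)
    (hθδ : ∀ a' ∈ W.torsionFilAt (cd.σ • v) ((p : ℤ) ^ k),
      θ (W.torsionGaloisModule ((p : ℤ) ^ k) (cd.δ v) a') ∈ W.torsionFilAt v ((p : ℤ) ^ k))
    {x : galoisCohomology ((κ.eisensteinTwist (W.torsionGaloisModule ((p : ℤ) ^ k)) hm k).toLocal (Sum.inr v)) 1}
    (hx : x ∈ (W.ordinaryFiltrationAt v t ht).ordinaryCore hm k)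
    {y : galoisCohomology ((cd.twist (κ.eisensteinTwist (W.torsionGaloisModule ((p : ℤ) ^ k)) hm k)).toLocal (Sum.inr v)) 1}
    (hy : y ∈ ((W.ordinaryFiltrationAt (cd.σ • v) t ht).ordinaryCore hm k).map
      (cd.transportH1 (κ.eisensteinTwist (W.torsionGaloisModule ((p : ℤ) ^ k)) hm k) v)) :
    (eisensteinDualityDatum hm k cd κ (W.torsionGaloisModule ((p : ℤ) ^ k)) (conjPairing e θ log) hsymm hequiv hnd hex
      hκ).localCup (Sum.inr v) x y = 0 :=
  (W.isotropic_ordinaryCore_of_not_dvd_frobeniusTraceAt hm k cd κ t ht e θ log hsymm hequiv hnd hex hκ v hgood hpv hord hself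
    hθδ).1 x hx y hy

end WeierstrassCurve

end
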